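import Literature.AlgebraicGeometry.Resolution.BlowupSNC
import Literature.AlgebraicGeometry.Resolution.BlowupsIntegral
import Literature.AlgebraicGeometry.Resolution.BlowupsFlatBaseChange
import Literature.AlgebraicGeometry.Resolution.ColonIdealSheafFG
import Literature.AlgebraicGeometry.Resolution.MarkedIdealsEtale
import Literature.AlgebraicGeometry.Resolution.NormalCrossingsLocal
import Literature.AlgebraicGeometry.Resolution.EtaleVanishingIdeal
import Literature.AlgebraicGeometry.Resolution.ResolutionGlue
import Literature.AlgebraicGeometry.Resolution.MonomialOrderReductionUnit
import Mathlib.AlgebraicGeometry.Morphisms.Etale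
import HarnessLib

/-!
# A blowing up changes nothing away from its centre: stalks, orders, supports, reduced preimages

Topic: `Literature/AlgebraicGeometry/Resolution`. For a blowing up `π : X' → X` along the ideal sheaf `C` (universal
property, Görtz–Wedhorn I Def. 13.90 = the tree's `IsBlowup`), the restriction of `π` over the open complement
`X ∖ V(C)` is an isomorphism (Görtz–Wedhorn I, Prop. 13.91 (3) = Stacks 02OS; tree `IsBlowup.isIso_compl`). This file
spells out the consequences that a RE-SEQUENCING of blow-ups with pairwise disjoint centres consumes (cell res-hironaka,
seat res-D-pv-060, piece F3a of res-type-001's plan for the Γ-monomial case; the companion `IsBlowup.comp`, Stacks 080A,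
is `BlowupsProduct.lean`): at a point `x′` with `π x′ ∉ V(C)`, and for a closed `Z ⊆ X` disjoint from `V(C)`,

* `IsBlowup.stalkIdeal_comap_centre_eq_top` — the exceptional ideal `C·𝒪_{X′}` is the unit ideal at `x′`;
* `IsBlowup.stalkIdeal_strictTransformIdeal_of_not_mem` — the strict transform of `V(K)` has stalk `(π^*K)_{x′}`;
* `IsBlowup.stalkIdeal_controlledTransform_of_not_mem` — the controlled transform `(π^*J : (C𝒪)^b)` has stalk
  `(π^*J)_{x′}`;
* `IsBlowup.idealOrder_comap_of_not_mem`, `IsBlowup.idealOrder_controlledTransform_of_not_mem` —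
  `ord_{x′}(π^*J) = ord_{x′}(πᶜ(J, b)) = ord_{π x′}(J)` («étale morphisms preserve multiplicities», BGMW Lemma 8.0.3,
  applied to the open immersion `π⁻¹(X ∖ V(C)) → X`);
* (already in the tree, `MonomialOrderReductionUnit.lean`: `IsBlowup.isIso_stalkMap_of_not_mem_support`,
  `IsBlowup.mem_support_transform_iff_of_not_mem` — `x′ ∈ supp(πᶜM) ↔ π x′ ∈ supp M`; imported, not restated);
* `IsBlowup.comap_vanishingIdeal_of_disjoint` — `π^* 𝓘_Z = 𝓘_{π⁻¹Z}` for the REDUCED ideal sheaves (radicality is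
  stalk-local and holds over the open where `π` is an open immersion, Stacks 033B for open immersions);
* `IsBlowup.isIrreducible_preimage_of_disjoint` — `π⁻¹Z` is irreducible if `Z` is;
* `IsBlowup.isRegular_subscheme_vanishingIdeal_preimage` — the reduced closed subscheme on `π⁻¹Z` is regular if the one
  on `Z` is (regular centres pull back along étale maps, BGMW Thm. 8.0.5 with Def. 3.1.3, applied over `X ∖ V(C)`).

Everything here is proved; the sources are cited for the underlying facts.

## Sources

* U. Görtz, T. Wedhorn, *Algebraic Geometry I* (2nd ed. 2020), Def. 13.90, Prop. 13.91 (3) p. 414. [GortzWedhorn2020]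
* The Stacks Project, Tags 02OS (blowing up is an isomorphism away from the centre), 033B. [StacksProject]
* E. Bierstone, D. Grigoriev, P. Milman, J. Włodarczyk, arXiv:1206.3090, Lemma 8.0.3, Thm. 8.0.5.
  [BierstoneGrigorievMilmanWlodarczyk2011]
-/

noncomputable section

open CategoryTheory CategoryTheory.Limits AlgebraicGeometry TopologicalSpace IsLocalRing

namespace Literature.AlgebraicGeometry.Resolution

universe u

open Scheme.IdealSheafData

variable {X X' : Scheme.{u}} {π : X' ⟶ X} {C : X.IdealSheafData}

/-! ## Stalks off the centre -/

/-- **Off the centre the exceptional ideal is the unit ideal**: `(C·𝒪_{X′})_{x′} = ⊤` when `π x′ ∉ V(C)`.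
[cite: GortzWedhorn2020, Prop. 13.91 (3) p. 414] -/
theorem IsBlowup.stalkIdeal_comap_centre_eq_top (_hπ : IsBlowup π C) {x' : X'}
    (hx : π x' ∉ (C.support : Set X)) : stalkIdeal (C.comap π) x' = ⊤ := by
  apply stalkIdeal_eq_top_of_not_mem_support
  rw [Scheme.IdealSheafData.support_comap]
  exact hx

/-- **Off the centre the strict transform of `V(K)` is the total transform**: its stalk at `x′` is `(π^*K)_{x′}`
(the saturation by the unit ideal does nothing). [cite: GortzWedhorn2020, (13.19) p. 414] -/
theorem IsBlowup.stalkIdeal_strictTransformIdeal_of_not_mem [IsLocallyNoetherian X] [IsLocallyNoetherian X']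
    (hπ : IsBlowup π C) (K : X.IdealSheafData) {x' : X'} (hx : π x' ∉ (C.support : Set X)) :
    stalkIdeal (strictTransformIdeal π C K) x' = stalkIdeal (K.comap π) x' := by
  rw [stalkIdeal_strictTransformIdeal π C K x', hπ.stalkIdeal_comap_centre_eq_top hx,
    stalkIdeal_comap_eq_map_stalkMap]
  refine le_antisymm (iSup_le fun n => ?_) ?_
  · intro y hy
    have h1 : y * 1 ∈ (stalkIdeal K (π x')).map (π.stalkMap x').hom := by
      refine Submodule.mem_colon.mp hy 1 ?_
      rw [Ideal.top_pow]; trivial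
    simpa using h1
  · refine le_trans ?_ (le_iSup _ 0)
    intro y hy
    exact Submodule.mem_colon.mpr fun a _ => Ideal.mul_mem_right a _ hy

/-- **Off the centre the controlled transform is the total transform**: `(πᶜ(J, b))_{x′} = (π^*J)_{x′}` when
`π x′ ∉ V(C)`. [cite: BierstoneGrigorievMilmanWlodarczyk2011, §3.2] -/
theorem IsBlowup.stalkIdeal_controlledTransform_of_not_mem (hπ : IsBlowup π C) (J : X.IdealSheafData) (b : ℕ)
    {x' : X'} (hx : π x' ∉ (C.support : Set X)) :
    stalkIdeal (controlledTransform π C J b) x' = stalkIdeal (J.comap π) x' := by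
  rw [hπ.stalkIdeal_controlledTransform J b x', hπ.stalkIdeal_comap_centre_eq_top hx, Ideal.top_pow]
  refine le_antisymm ?_ ?_
  · intro y hy
    have h1 : y * 1 ∈ stalkIdeal (J.comap π) x' := Submodule.mem_colon.mp hy 1 trivial
    simpa using h1
  · intro y hy
    exact Submodule.mem_colon.mpr fun a _ => Ideal.mul_mem_right a _ hy

/-! ## Orders and supports off the centre -/

/-- The order of an ideal sheaf only depends on the stalk. [folklore] -/
private theorem idealOrder_congr_of_stalkIdeal_eq {I I' : X'.IdealSheafData} {x' : X'}
    (h : stalkIdeal I x' = stalkIdeal I' x') : idealOrder I x' = idealOrder I' x' := by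
  refine ENat.eq_of_forall_natCast_le_iff fun n => ?_
  rw [le_idealOrder_iff, le_idealOrder_iff, h]

/-- **Orders of pull-backs off the centre**: `ord_{x′}(π^*J) = ord_{π x′}(J)` when `π x′ ∉ V(C)` — over
`X ∖ V(C)` the blowing up is an open immersion, and étale morphisms preserve multiplicities (BGMW Lemma 8.0.3, tree
`idealOrder_comap_of_etale`). [cite: BierstoneGrigorievMilmanWlodarczyk2011, Lemma 8.0.3 (2)] -/
theorem IsBlowup.idealOrder_comap_of_not_mem (hπ : IsBlowup π C) (J : X.IdealSheafData) {x' : X'}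
    (hx : π x' ∉ (C.support : Set X)) : idealOrder (J.comap π) x' = idealOrder J (π x') := by
  have hxV : x' ∈ (π ⁻¹ᵁ centreCompl C) := hx
  haveI : IsOpenImmersion (((π ⁻¹ᵁ centreCompl C)).ι ≫ π) := hπ.isOpenImmersion_preimage_compl_ι
  have h1 : idealOrder ((J.comap π).comap ((π ⁻¹ᵁ centreCompl C)).ι) ⟨x', hxV⟩ = idealOrder (J.comap π) x' :=
    idealOrder_comap_of_etale ((π ⁻¹ᵁ centreCompl C)).ι (J.comap π) ⟨x', hxV⟩
  have h2 : idealOrder (J.comap (((π ⁻¹ᵁ centreCompl C)).ι ≫ π)) ⟨x', hxV⟩ = idealOrder J (π x') :=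
    idealOrder_comap_of_etale (((π ⁻¹ᵁ centreCompl C)).ι ≫ π) J ⟨x', hxV⟩
  rw [Scheme.IdealSheafData.comap_comp] at h2
  rw [← h1, h2]

/-- **Orders of controlled transforms off the centre**: `ord_{x′}(πᶜ(J, b)) = ord_{π x′}(J)` when `π x′ ∉ V(C)`.
[cite: BierstoneGrigorievMilmanWlodarczyk2011, Lemma 8.0.3 (2) with §3.2] -/
theorem IsBlowup.idealOrder_controlledTransform_of_not_mem (hπ : IsBlowup π C) (J : X.IdealSheafData) (b : ℕ)
    {x' : X'} (hx : π x' ∉ (C.support : Set X)) :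
    idealOrder (controlledTransform π C J b) x' = idealOrder J (π x') := by
  rw [idealOrder_congr_of_stalkIdeal_eq (hπ.stalkIdeal_controlledTransform_of_not_mem J b hx),
    hπ.idealOrder_comap_of_not_mem J hx]

/-- Radicality descends along a bijective ring map. [folklore] -/
private theorem isRadical_of_map_bijective {R S : Type*} [CommRing R] [CommRing S] (f : R →+* S)
    (hf : Function.Bijective f) {J : Ideal R} (h : (J.map f).IsRadical) : J.IsRadical := by
  rw [← Ideal.comap_map_of_bijective f hf (I := J)]
  intro x hx
  rw [← Ideal.comap_radical] at hx
  exact h hx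

/-! ## Reduced preimages of closed sets disjoint from the centre -/

section Preimage

variable (hπ : IsBlowup π C) (Z : Closeds X) (hZ : Disjoint (Z : Set X) (C.support : Set X))
include hπ hZ

/-- **The reduced ideal sheaf of `Z` pulls back to the reduced ideal sheaf of `π⁻¹Z`** when `Z` is disjoint from the
centre (`X` locally Noetherian): `π^*𝓘_Z` has support `π⁻¹Z` and is radical at every point — over `X ∖ V(C)` because
there `π` is an open immersion (Stacks 033B for open immersions, tree `comap_vanishingIdeal_of_isOpenImmersion`), and
elsewhere because its stalk is the unit ideal. [cite: StacksProject, Tag 033B] -/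
theorem IsBlowup.comap_vanishingIdeal_of_disjoint [IsLocallyNoetherian X] :
    (vanishingIdeal Z).comap π = vanishingIdeal (Z.preimage π.continuous) := by
  haveI : IsOpenImmersion (((π ⁻¹ᵁ centreCompl C)).ι ≫ π) := hπ.isOpenImmersion_preimage_compl_ι
  apply eq_vanishingIdeal_of_radical
  · rw [radical_eq_iff_forall_stalkIdeal]
    intro x'
    by_cases hxZ : π x' ∈ (Z : Set X)
    · -- over `Z ⊆ X ∖ V(C)`: compare with the pull-back along the open immersion `π⁻¹(X ∖ V(C)) → X`
      have hx : π x' ∉ (C.support : Set X) := fun h => hZ.le_bot ⟨hxZ, h⟩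
      have hxV : x' ∈ (π ⁻¹ᵁ centreCompl C) := hx
      let V := (π ⁻¹ᵁ centreCompl C)
      have hrad : (stalkIdeal ((vanishingIdeal Z).comap (V.ι ≫ π)) ⟨x', hxV⟩).IsRadical := by
        rw [comap_vanishingIdeal_of_isOpenImmersion]
        exact isRadical_stalkIdeal_vanishingIdeal _ _
      rw [Scheme.IdealSheafData.comap_comp, stalkIdeal_comap_eq_map_stalkMap] at hrad
      -- the stalk map of the open immersion `V.ι` is bijective
      exact isRadical_of_map_bijective _ (ConcreteCategory.bijective_of_isIso (V.ι.stalkMap ⟨x', hxV⟩)) hrad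
    · -- off `π⁻¹Z` the stalk is the unit ideal
      have hns : x' ∉ (((vanishingIdeal Z).comap π).support : Set X') := by
        rw [Scheme.IdealSheafData.support_comap]
        change π x' ∉ ((vanishingIdeal Z).support : Set X)
        rw [coe_support_vanishingIdeal]
        exact hxZ
      rw [stalkIdeal_eq_top_of_not_mem_support hns]
      intro y _
      trivial
  · rw [Scheme.IdealSheafData.support_comap]
    ext1
    rw [Closeds.coe_preimage, coe_support_vanishingIdeal, Closeds.coe_preimage]

/-- **`π⁻¹Z` is irreducible if `Z` is**, for `Z` disjoint from the centre: over `X ∖ V(C)` the blowing up is a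
homeomorphism. [cite: GortzWedhorn2020, Prop. 13.91 (3) p. 414] -/
theorem IsBlowup.isIrreducible_preimage_of_disjoint (hirr : IsIrreducible (Z : Set X)) :
    IsIrreducible (π ⁻¹' (Z : Set X)) := by
  haveI : IsOpenImmersion (((π ⁻¹ᵁ centreCompl C)).ι ≫ π) := hπ.isOpenImmersion_preimage_compl_ι
  let j : ((π ⁻¹ᵁ centreCompl C) : Scheme.{u}) ⟶ X := ((π ⁻¹ᵁ centreCompl C)).ι ≫ π
  have hemb : Topology.IsOpenEmbedding j := j.isOpenEmbedding
  -- `Z` lies in the range of `j`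
  have hZr : (Z : Set X) ⊆ Set.range j := by
    intro z hz
    have hzC : z ∉ (C.support : Set X) := fun h => hZ.le_bot ⟨hz, h⟩
    -- `π` is surjective over `X ∖ V(C)` (an isomorphism there)
    haveI : IsIso (π ∣_ centreCompl C) := hπ.isIso_compl
    obtain ⟨w, hw⟩ := (π ∣_ centreCompl C).homeomorph.surjective ⟨z, hzC⟩
    refine ⟨w, ?_⟩
    have := congrArg Subtype.val hw
    simpa [j, morphismRestrict_base_coe] using this
  have h1 : IsIrreducible (j ⁻¹' (Z : Set X)) := by
    refine ⟨?_, hirr.2.preimage hemb⟩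
    obtain ⟨z, hz⟩ := hirr.1
    obtain ⟨w, hw⟩ := hZr hz
    exact ⟨w, by rw [Set.mem_preimage, hw]; exact hz⟩
  have h2 : π ⁻¹' (Z : Set X) = ((π ⁻¹ᵁ centreCompl C)).ι '' (j ⁻¹' (Z : Set X)) := by
    ext x'
    constructor
    · intro hx'
      have hx : π x' ∉ (C.support : Set X) := fun h => hZ.le_bot ⟨hx', h⟩
      exact ⟨⟨x', hx⟩, hx', rfl⟩
    · rintro ⟨w, hw, rfl⟩
      exact hw
  rw [h2]
  exact h1.image _ ((π ⁻¹ᵁ centreCompl C)).ι.continuous.continuousOn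

/-- **The reduced closed subscheme on `π⁻¹Z` is regular if the one on `Z` is**, for `Z` disjoint from the centre
(`X` locally Noetherian): regular centres pull back along the open immersion `π⁻¹(X ∖ V(C)) → X` (BGMW Thm. 8.0.5
with Def. 3.1.3, tree `Scheme.IsRegular.subscheme_comap_of_etale`), and the subscheme of `X′` cut out by `π^*𝓘_Z`,
whose support lies in that open, is the same scheme. [cite: BierstoneGrigorievMilmanWlodarczyk2011, Thm. 8.0.5 with Def. 3.1.3] -/
theorem IsBlowup.isRegular_subscheme_vanishingIdeal_preimage [IsLocallyNoetherian X]
    (hreg : Scheme.IsRegular (vanishingIdeal Z).subscheme) :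
    Scheme.IsRegular (vanishingIdeal (Z.preimage π.continuous)).subscheme := by
  haveI : IsOpenImmersion (((π ⁻¹ᵁ centreCompl C)).ι ≫ π) := hπ.isOpenImmersion_preimage_compl_ι
  rw [← hπ.comap_vanishingIdeal_of_disjoint Z hZ]
  set I : X'.IdealSheafData := (vanishingIdeal Z).comap π with hI
  let V : X'.Opens := (π ⁻¹ᵁ centreCompl C)
  -- regular over the open `V`
  have hV : Scheme.IsRegular (I.comap V.ι).subscheme := by
    rw [hI, ← Scheme.IdealSheafData.comap_comp]
    exact Scheme.IsRegular.subscheme_comap_of_etale (V.ι ≫ π) _ hreg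
  -- `V(I.comap V.ι) = V(I) ×_{X'} V → V(I)` is an open immersion onto everything
  have hsupp : (I.support : Set X') ⊆ (V : Set X') := by
    intro x' hx'
    rw [hI, Scheme.IdealSheafData.support_comap] at hx'
    change π x' ∈ ((vanishingIdeal Z).support : Set X) at hx'
    rw [coe_support_vanishingIdeal] at hx'
    exact fun h => hZ.le_bot ⟨hx', h⟩
  let g : (I.comap V.ι).subscheme ⟶ I.subscheme := (I.comapIso V.ι).hom ≫ pullback.snd V.ι I.subschemeι
  haveI : IsOpenImmersion (pullback.snd V.ι I.subschemeι) := MorphismProperty.pullback_snd _ _ inferInstance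
  haveI : IsOpenImmersion g := inferInstance
  have hrange : Set.range (pullback.snd V.ι I.subschemeι) = Set.univ := by
    rw [Scheme.Pullback.range_snd, Set.eq_univ_iff_forall]
    intro y
    have hy : I.subschemeι y ∈ (V : Set X') := hsupp (I.range_subschemeι ▸ Set.mem_range_self y)
    exact ⟨⟨I.subschemeι y, hy⟩, rfl⟩
  have htop : g.opensRange = ⊤ := by
    apply TopologicalSpace.Opens.ext
    rw [Scheme.Hom.coe_opensRange, TopologicalSpace.Opens.coe_top, Set.eq_univ_iff_forall]
    intro y
    obtain ⟨w, hw⟩ := (Set.eq_univ_iff_forall.mp hrange) y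
    obtain ⟨v, hv⟩ := (I.comapIso V.ι).hom.homeomorph.surjective w
    refine ⟨v, ?_⟩
    have hv' : (I.comapIso V.ι).hom.base v = w := hv
    rw [← hw, ← hv']
    rfl
  haveI : IsIso g := isIso_of_isOpenImmersion_of_opensRange_eq_top g htop
  exact Scheme.IsRegular.of_iso g hV

end Preimage

end Literature.AlgebraicGeometry.Resolution

end
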